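import Summits.Langlands.Langlands.Theorems.PicardMuOrdinaryMuOrdinaryFamilyRTThorneReduction
import HarnessLib

/-!
# Crux `MuOrdinaryFamilyRT` (stmt-Langlands-13757): the route-level SPLIT of the crux along the attached
# μ-ordinary `S₄` representation — three children and the kernel-checked glue (crux-strategist s1, 2026-08-17)

The crux `Summit.Langlands.Langlands.Theses.PicardMuOrdinary.MuOrdinaryFamilyRT` quantifies over EVERY generic quartic `f`.
Every registered line of the crux (seven skeletons, six of them certified dead, and the live `thorne-minimal-lift`) proves
it only on a SCOPE — `f` whose `3`-adic Picard representation `ρ_C` is μ-ordinary (B-ordinary) at `λ = (1 − ω)` with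
`S₄` heart over `K = ℚ(ω)` (and, for the live line, potentially unramified away from `3`) — and carries the complement as
a conceded stub that is the crux verbatim on its domain (`S.stub_remainder`, `T.stub_remainderPlus`; Disproof F8/F12c:
on the wild-supercuspidal part of the complement the typed conclusion is not even predicted by reciprocity + Zariski
density).  This file makes that scope a ROUTE-LEVEL case distinction, so that the part the live line can deliver becomes
an item of its own and the complement becomes a first-class (negation-minded) item:

* `AttachedMinimal f`  — some `3`-adic representation attached to `f` (char-zero's `PicardInput`: absolutely irreducible,
  unramified outside a finite `S₀ ∋ λ`, geometric-Frobenius traces `ι⁻¹ e (a_𝔭(f))`) lies in the live line's scope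
  `MainClassPlus` (μ-ordinary at `λ`, `disc f ∉ ℚ^{×2} ∪ −3ℚ^{×2}`, potentially unramified at `S₀ ∖ λ`);
* `AttachedOrdinary f` — the same with char-zero's `MainClass` only (no minimality away from `3`);
* child A `RTMuOrdinaryMinimal`    := the crux for `f` with `AttachedMinimal f`      (the live line's deliverable);
* child B `RTMuOrdinaryNonMinimal` := the crux for `f` with `¬ AttachedMinimal f ∧ AttachedOrdinary f`
  (μ-ordinary `S₄`, but toric reduction of the Jacobian at some `v ∤ 3`: needs a non-minimal seed / level raising);
* child C `RTRemainder`            := the crux for `f` with `¬ AttachedOrdinary f` (λ-supersingular BBW types (a), (c),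
  toric at `3` (d), (e), or heart image `A₄` over `K`; and — vacuously in truth — `f` with no typed attached representation);
* `MuOrdinaryFamilyRT_of_subs : A → B → C → MuOrdinaryFamilyRT` (two `by_cases`), its converse, and the `Iff`;
* `rtMuOrdinaryMinimal_iff` / `rtMuOrdinaryNonMinimal_iff` / `rtRemainder_iff` (`Iff.rfl`): each child EQUALS, definitionally,
  the self-contained one-line statement filed in the route file (Mathlib + Literature vocabulary only);
* how the live line's registered stubs distribute over the children (real proofs, no new stub):
  `rtMuOrdinaryMinimal_of_plus` (child A from `T.stub_minimalFamily`, `T.stub_definiteHostPlus`, `S.stub_quadraticDescent`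
  and the landed `stub_accumulation`, `stub_dictionary` — WITHOUT `T.stub_remainderPlus` and WITHOUT the Picard fact
  `S.stub_picardInput`, which the hypothesis `AttachedMinimal f` replaces), `rtMuOrdinaryMinimal_of_thorneStubs`
  (the same from the four real stubs of the skeleton + the descent facts), `rtMuOrdinaryNonMinimal_of_remainderPlus`,
  `rtRemainder_of_remainderPlus`.

Why this cut (STRATEGY-CENSUS.md §Decomposition of the crux dir): the existential form puts the burden of comparing two
attached representations on nobody — child A's prover instantiates the line AT the witness; `¬ AttachedOrdinary f` is,
modulo `picardCurve_exists_lambdaAdicRep` + Chebotarev/Brauer–Nesbitt uniqueness, exactly "`ρ_C` is λ-non-ordinary or has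
heart `A₄`", the class on which kill criterion (4) of the route can fire.  Nothing here discharges a stub.
-/

set_option linter.dupNamespace false

namespace Summit.Langlands.Langlands.Cruxes.MuOrdinaryFamilyRT.Split

open scoped NumberField Polynomial Matrix Classical
open Field IsDedekindDomain Polynomial
open Literature.NumberTheory.GaloisRepresentations Literature.NumberTheory.Automorphic
open Summit.Langlands.Langlands.Cruxes.MuOrdinaryFamilyRT.CharZeroDominance
open Summit.Langlands.Langlands.Cruxes.MuOrdinaryFamilyRT.ThorneMinimalLift
open Summit.Langlands.Langlands.Theses.PicardMuOrdinary (MuOrdinaryFamilyRT)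

noncomputable section

/-! ## 1. The split predicates and the three children -/

/-- **`AttachedMinimal f`**: some `3`-adic representation attached to `f` (`PicardInput`) is in the live line's scope
`MainClassPlus` (μ-ordinary at `λ`, `S₄` heart over `K`, potentially unramified away from `3`). -/
def AttachedMinimal (f : ℤ[X]) : Prop :=
  ∃ (ι : PadicAlgCl 3 ≃+* ℂ) (e : K →+* ℂ) (S₀ : Finset (HeightOneSpectrum (𝓞 K)))
    (ρ : FramedGaloisRep K (PadicAlgCl 3) 3), PicardInput f ι e S₀ ρ ∧ MainClassPlus f S₀ ρ

/-- **`AttachedOrdinary f`**: some `3`-adic representation attached to `f` is μ-ordinary at `λ` with `S₄` heart over `K`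
(char-zero's `MainClass`; no minimality away from `3`). -/
def AttachedOrdinary (f : ℤ[X]) : Prop :=
  ∃ (ι : PadicAlgCl 3 ≃+* ℂ) (e : K →+* ℂ) (S₀ : Finset (HeightOneSpectrum (𝓞 K)))
    (ρ : FramedGaloisRep K (PadicAlgCl 3) 3), PicardInput f ι e S₀ ρ ∧ MainClass f ρ

theorem attachedOrdinary_of_attachedMinimal {f : ℤ[X]} (h : AttachedMinimal f) : AttachedOrdinary f := by
  obtain ⟨ι, e, S₀, ρ, hin, hM⟩ := h
  exact ⟨ι, e, S₀, ρ, hin, hM.1⟩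

/-- **Child A — `RTMuOrdinaryMinimal`** (the live line's deliverable): the crux for generic `f` admitting an attached
representation in `MainClassPlus`. -/
def RTMuOrdinaryMinimal : Prop :=
  ∀ (f : ℤ[X]) (hcpt : isCompact_glFiniteIntegralLevel 3 (CyclotomicField 3 ℚ)),
    f.natDegree = 4 → (f.map (Int.castRingHom ℚ)).Separable → 12 ∣ Nat.card (f.map (Int.castRingHom ℚ)).Gal →
    AttachedMinimal f → ResidualHyp f hcpt → LimitConcl f hcpt

/-- **Child B — `RTMuOrdinaryNonMinimal`**: the crux for generic `f` with an attached μ-ordinary `S₄` representation but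
none that is also potentially unramified away from `3` (toric reduction of `J(C_f)` at some `v ∤ 3`). -/
def RTMuOrdinaryNonMinimal : Prop :=
  ∀ (f : ℤ[X]) (hcpt : isCompact_glFiniteIntegralLevel 3 (CyclotomicField 3 ℚ)),
    f.natDegree = 4 → (f.map (Int.castRingHom ℚ)).Separable → 12 ∣ Nat.card (f.map (Int.castRingHom ℚ)).Gal →
    ¬ AttachedMinimal f → AttachedOrdinary f → ResidualHyp f hcpt → LimitConcl f hcpt

/-- **Child C — `RTRemainder`**: the crux for generic `f` with NO attached μ-ordinary `S₄` representation. -/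
def RTRemainder : Prop :=
  ∀ (f : ℤ[X]) (hcpt : isCompact_glFiniteIntegralLevel 3 (CyclotomicField 3 ℚ)),
    f.natDegree = 4 → (f.map (Int.castRingHom ℚ)).Separable → 12 ∣ Nat.card (f.map (Int.castRingHom ℚ)).Gal →
    ¬ AttachedOrdinary f → ResidualHyp f hcpt → LimitConcl f hcpt

/-! ## 2. The glue (registered handle: `MuOrdinaryFamilyRT_of_subs`) and its converse -/

/-- **The crux from its three children** (pure logic: two case distinctions on `AttachedMinimal f`, `AttachedOrdinary f`). -/
theorem MuOrdinaryFamilyRT_of_subs : RTMuOrdinaryMinimal → RTMuOrdinaryNonMinimal → RTRemainder → MuOrdinaryFamilyRT := by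
  intro hA hB hC f hcpt hdeg hsep hgal hres
  by_cases h₁ : AttachedMinimal f
  · exact hA f hcpt hdeg hsep hgal h₁ hres
  · by_cases h₂ : AttachedOrdinary f
    · exact hB f hcpt hdeg hsep hgal h₁ h₂ hres
    · exact hC f hcpt hdeg hsep hgal h₂ hres

/-- The split loses nothing: the crux gives back all three children. -/
theorem subs_of_MuOrdinaryFamilyRT (h : MuOrdinaryFamilyRT) : RTMuOrdinaryMinimal ∧ RTMuOrdinaryNonMinimal ∧ RTRemainder :=
  ⟨fun f hcpt hdeg hsep hgal _ hres => h f hcpt hdeg hsep hgal hres,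
   fun f hcpt hdeg hsep hgal _ _ hres => h f hcpt hdeg hsep hgal hres,
   fun f hcpt hdeg hsep hgal _ hres => h f hcpt hdeg hsep hgal hres⟩

/-- The split is an equivalence. -/
theorem MuOrdinaryFamilyRT_iff_subs : MuOrdinaryFamilyRT ↔ (RTMuOrdinaryMinimal ∧ RTMuOrdinaryNonMinimal ∧ RTRemainder) :=
  ⟨subs_of_MuOrdinaryFamilyRT, fun h => MuOrdinaryFamilyRT_of_subs h.1 h.2.1 h.2.2⟩

/-! ## 3. The children equal, DEFINITIONALLY, the self-contained statements filed in the route file -/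

/-- Child A, unfolded to Mathlib + Literature vocabulary (the exact term filed as the route item `RTMuOrdinaryMinimal`). -/
theorem rtMuOrdinaryMinimal_iff : RTMuOrdinaryMinimal ↔ (∀ (f : Polynomial ℤ) (hcpt : Literature.NumberTheory.Automorphic.isCompact_glFiniteIntegralLevel 3 (CyclotomicField 3 ℚ)), f.natDegree = 4 → (f.map (Int.castRingHom ℚ)).Separable → 12 ∣ Nat.card (f.map (Int.castRingHom ℚ)).Gal → (∃ (ι : PadicAlgCl 3 ≃+* ℂ) (e : (CyclotomicField 3 ℚ) →+* ℂ) (S₀ : Finset (IsDedekindDomain.HeightOneSpectrum (NumberField.RingOfIntegers (CyclotomicField 3 ℚ)))) (ρ : Literature.NumberTheory.GaloisRepresentations.FramedGaloisRep (CyclotomicField 3 ℚ) (PadicAlgCl 3) 3), ((∀ v : IsDedekindDomain.HeightOneSpectrum (NumberField.RingOfIntegers (CyclotomicField 3 ℚ)), ((3 : ℕ) : (NumberField.RingOfIntegers (CyclotomicField 3 ℚ))) ∈ v.asIdeal → v ∈ S₀) ∧ Literature.NumberTheory.GaloisRepresentations.FramedRep.IsAbsolutelyIrreducible ρ ∧ ∀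 𝔭 ∉ S₀, ρ.IsUnramifiedAt 𝔭 ∧ ∀ 𝔓 ∈ 𝔭.primesAbove, ∀ τ : Field.absoluteGaloisGroup (CyclotomicField 3 ℚ), IsArithFrobAt (NumberField.RingOfIntegers (CyclotomicField 3 ℚ)) τ 𝔓 → Literature.NumberTheory.GaloisRepresentations.FramedRep.trace ρ τ⁻¹ = ι.symm (e (Literature.NumberTheory.GaloisRepresentations.picardTrace f 𝔭))) ∧ (((∀ v : IsDedekindDomain.HeightOneSpectrum (NumberField.RingOfIntegers (CyclotomicField 3 ℚ)), (3 : (NumberField.RingOfIntegers (CyclotomicField 3 ℚ))) ∈ v.asIdeal → ∃ (g : Matrix.GeneralLinearGroup (Fin 3) (PadicAlgCl 3)) (U : OpenSubgroup (Field.absoluteGaloisGroup (v.adicCompletion (CyclotomicField 3 ℚ)))) (i k : Fin 3) (s : ℤ), i ≠ k ∧ (i = 0 ∨ i = 2) ∧ (k = 0 ∨ k = 2) ∧ (s = 1 ∨ s = -1) ∧ (∀ τ : Field.absoluteGaloisGroup (v.adicCompletion (CyclotomicField 3 ℚ)), (g⁻¹ * ρ (Literature.NumberTheory.GaloisRepresentations.absGaloisRestrict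 (CyclotomicField 3 ℚ) (v.adicCompletion (CyclotomicField 3 ℚ)) τ) * g).val 1 0 = 0 ∧ (g⁻¹ * ρ (Literature.NumberTheory.GaloisRepresentations.absGaloisRestrict (CyclotomicField 3 ℚ) (v.adicCompletion (CyclotomicField 3 ℚ)) τ) * g).val 2 0 = 0 ∧ (g⁻¹ * ρ (Literature.NumberTheory.GaloisRepresentations.absGaloisRestrict (CyclotomicField 3 ℚ) (v.adicCompletion (CyclotomicField 3 ℚ)) τ) * g).val 2 1 = 0) ∧ (∀ τ ∈ Literature.NumberTheory.GaloisRepresentations.absInertia (v.adicCompletion (CyclotomicField 3 ℚ)), τ ∈ U → (g⁻¹ * ρ (Literature.NumberTheory.GaloisRepresentations.absGaloisRestrict (CyclotomicField 3 ℚ) (v.adicCompletion (CyclotomicField 3 ℚ)) τ) * g).val i i = 1 ∧ (g⁻¹ * ρ (Literature.NumberTheory.GaloisRepresentations.absGaloisRestrict (CyclotomicField 3 ℚ) (v.adicCompletion (CyclotomicField 3 ℚ)) τ) * g).val k k = algebraMap ℤ_[3] (PadicAlgCl 3) (((Literature.NumberTheory.GaloisRepresentations.GaloisRep.cyclotomicCharacter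 (v.adicCompletion (CyclotomicField 3 ℚ)) 3 τ) ^ s : ℤ_[3]ˣ) : ℤ_[3])) ∧ (∀ U' : OpenSubgroup (Field.absoluteGaloisGroup (v.adicCompletion (CyclotomicField 3 ℚ))), ∃ τ ∈ U', (g⁻¹ * ρ (Literature.NumberTheory.GaloisRepresentations.absGaloisRestrict (CyclotomicField 3 ℚ) (v.adicCompletion (CyclotomicField 3 ℚ)) τ) * g).val k k ≠ algebraMap ℤ_[3] (PadicAlgCl 3) (((Literature.NumberTheory.GaloisRepresentations.GaloisRep.cyclotomicCharacter (v.adicCompletion (CyclotomicField 3 ℚ)) 3 τ) ^ s : ℤ_[3]ˣ) : ℤ_[3]) * (g⁻¹ * ρ (Literature.NumberTheory.GaloisRepresentations.absGaloisRestrict (CyclotomicField 3 ℚ) (v.adicCompletion (CyclotomicField 3 ℚ)) τ) * g).val i i)) ∧ ¬ IsSquare (f.map (Int.castRingHom ℚ)).discr ∧ ¬ IsSquare ((-3 : ℚ) * (f.map (Int.castRingHom ℚ)).discr)) ∧ (∀ v ∈ S₀, ((3 : ℕ) : (NumberField.RingOfIntegers (CyclotomicField 3 ℚ))) ∉ v.asIdeal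 → ∃ U : OpenSubgroup (Field.absoluteGaloisGroup (v.adicCompletion (CyclotomicField 3 ℚ))), ∀ τ ∈ Literature.NumberTheory.GaloisRepresentations.absInertia (v.adicCompletion (CyclotomicField 3 ℚ)), τ ∈ U → ρ (Literature.NumberTheory.GaloisRepresentations.absGaloisRestrict (CyclotomicField 3 ℚ) (v.adicCompletion (CyclotomicField 3 ℚ)) τ) = 1))) → (∃ (P : Literature.NumberTheory.Automorphic.CuspidalAutomorphicRepData 3 (CyclotomicField 3 ℚ) hcpt) (𝔐 : Ideal (integralClosure ℤ ℂ)), P.1.IsRegularAlgebraic ∧ 𝔐.IsMaximal ∧ (3 : (integralClosure ℤ ℂ)) ∈ 𝔐 ∧ ∀ᶠ 𝔭 : IsDedekindDomain.HeightOneSpectrum (NumberField.RingOfIntegers (CyclotomicField 3 ℚ)) in Filter.cofinite, ∃ (α : Multiset ℂ) (Q : Polynomial (integralClosure ℤ ℂ)), P.1.HasSatakeParamAt 𝔭 α ∧ Q.map (algebraMap (integralClosure ℤ ℂ) ℂ) = (α.map (fun a => Polynomial.X - Polynomial.C ((𝔭.residueCard : ℂ) * a))).prod ∧ Q.map (Ideal.Quotient.mk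 𝔐) = (if (f.map ((Ideal.Quotient.mk 𝔭.asIdeal).comp (algebraMap ℤ (NumberField.RingOfIntegers (CyclotomicField 3 ℚ))))).roots.toFinset.card = 4 then (Polynomial.X - 1) ^ 3 else if (f.map ((Ideal.Quotient.mk 𝔭.asIdeal).comp (algebraMap ℤ (NumberField.RingOfIntegers (CyclotomicField 3 ℚ))))).roots.toFinset.card = 2 then (Polynomial.X - 1) ^ 2 * (Polynomial.X + 1) else if (f.map ((Ideal.Quotient.mk 𝔭.asIdeal).comp (algebraMap ℤ (NumberField.RingOfIntegers (CyclotomicField 3 ℚ))))).roots.toFinset.card = 1 then Polynomial.X ^ 3 - 1 else if (∃ y : ((NumberField.RingOfIntegers (CyclotomicField 3 ℚ)) ⧸ 𝔭.asIdeal), y ^ 2 = (f.map ((Ideal.Quotient.mk 𝔭.asIdeal).comp (algebraMap ℤ (NumberField.RingOfIntegers (CyclotomicField 3 ℚ))))).discr) then (Polynomial.X - 1) * (Polynomial.X + 1) ^ 2 else Polynomial.X ^ 3 + Polynomial.X ^ 2 + Polynomial.X + 1 : Polynomial ℤ).map (Int.castRingHom ((integralClosure ℤ ℂ) ⧸ 𝔐)))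 → ∃ (e : CyclotomicField 3 ℚ →+* ℂ) (𝔐 : Ideal (integralClosure ℤ ℂ)) (S : Finset (IsDedekindDomain.HeightOneSpectrum (NumberField.RingOfIntegers (CyclotomicField 3 ℚ)))), 𝔐.IsMaximal ∧ (3 : (integralClosure ℤ ℂ)) ∈ 𝔐 ∧ ∀ k : ℕ, ∃ P : Literature.NumberTheory.Automorphic.CuspidalAutomorphicRepData 3 (CyclotomicField 3 ℚ) hcpt, P.1.IsRegularAlgebraic ∧ ∀ 𝔭 ∉ S, ∃ (α : Multiset ℂ) (t u : (integralClosure ℤ ℂ)), P.1.HasSatakeParamAt 𝔭 α ∧ (t : ℂ) = (𝔭.residueCard : ℂ) * α.sum - e (Literature.NumberTheory.GaloisRepresentations.picardTrace f 𝔭) ∧ u ∉ 𝔐 ∧ u * t ∈ Ideal.span {(3 : (integralClosure ℤ ℂ)) ^ k}) :=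
  Iff.rfl

/-- Child B, unfolded (the exact term filed as the route item `RTMuOrdinaryNonMinimal`). -/
theorem rtMuOrdinaryNonMinimal_iff : RTMuOrdinaryNonMinimal ↔ (∀ (f : Polynomial ℤ) (hcpt : Literature.NumberTheory.Automorphic.isCompact_glFiniteIntegralLevel 3 (CyclotomicField 3 ℚ)), f.natDegree = 4 → (f.map (Int.castRingHom ℚ)).Separable → 12 ∣ Nat.card (f.map (Int.castRingHom ℚ)).Gal → ¬ (∃ (ι : PadicAlgCl 3 ≃+* ℂ) (e : (CyclotomicField 3 ℚ) →+* ℂ) (S₀ : Finset (IsDedekindDomain.HeightOneSpectrum (NumberField.RingOfIntegers (CyclotomicField 3 ℚ)))) (ρ : Literature.NumberTheory.GaloisRepresentations.FramedGaloisRep (CyclotomicField 3 ℚ) (PadicAlgCl 3) 3), ((∀ v : IsDedekindDomain.HeightOneSpectrum (NumberField.RingOfIntegers (CyclotomicField 3 ℚ)), ((3 : ℕ) : (NumberField.RingOfIntegers (CyclotomicField 3 ℚ))) ∈ v.asIdeal → v ∈ S₀) ∧ Literature.NumberTheory.GaloisRepresentations.FramedRep.IsAbsolutelyIrreducible ρ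 ∧ ∀ 𝔭 ∉ S₀, ρ.IsUnramifiedAt 𝔭 ∧ ∀ 𝔓 ∈ 𝔭.primesAbove, ∀ τ : Field.absoluteGaloisGroup (CyclotomicField 3 ℚ), IsArithFrobAt (NumberField.RingOfIntegers (CyclotomicField 3 ℚ)) τ 𝔓 → Literature.NumberTheory.GaloisRepresentations.FramedRep.trace ρ τ⁻¹ = ι.symm (e (Literature.NumberTheory.GaloisRepresentations.picardTrace f 𝔭))) ∧ (((∀ v : IsDedekindDomain.HeightOneSpectrum (NumberField.RingOfIntegers (CyclotomicField 3 ℚ)), (3 : (NumberField.RingOfIntegers (CyclotomicField 3 ℚ))) ∈ v.asIdeal → ∃ (g : Matrix.GeneralLinearGroup (Fin 3) (PadicAlgCl 3)) (U : OpenSubgroup (Field.absoluteGaloisGroup (v.adicCompletion (CyclotomicField 3 ℚ)))) (i k : Fin 3) (s : ℤ), i ≠ k ∧ (i = 0 ∨ i = 2) ∧ (k = 0 ∨ k = 2) ∧ (s = 1 ∨ s = -1) ∧ (∀ τ : Field.absoluteGaloisGroup (v.adicCompletion (CyclotomicField 3 ℚ)), (g⁻¹ * ρ (Literature.NumberTheory.GaloisRepresentations.absGaloisRestrict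 (CyclotomicField 3 ℚ) (v.adicCompletion (CyclotomicField 3 ℚ)) τ) * g).val 1 0 = 0 ∧ (g⁻¹ * ρ (Literature.NumberTheory.GaloisRepresentations.absGaloisRestrict (CyclotomicField 3 ℚ) (v.adicCompletion (CyclotomicField 3 ℚ)) τ) * g).val 2 0 = 0 ∧ (g⁻¹ * ρ (Literature.NumberTheory.GaloisRepresentations.absGaloisRestrict (CyclotomicField 3 ℚ) (v.adicCompletion (CyclotomicField 3 ℚ)) τ) * g).val 2 1 = 0) ∧ (∀ τ ∈ Literature.NumberTheory.GaloisRepresentations.absInertia (v.adicCompletion (CyclotomicField 3 ℚ)), τ ∈ U → (g⁻¹ * ρ (Literature.NumberTheory.GaloisRepresentations.absGaloisRestrict (CyclotomicField 3 ℚ) (v.adicCompletion (CyclotomicField 3 ℚ)) τ) * g).val i i = 1 ∧ (g⁻¹ * ρ (Literature.NumberTheory.GaloisRepresentations.absGaloisRestrict (CyclotomicField 3 ℚ) (v.adicCompletion (CyclotomicField 3 ℚ)) τ) * g).val k k = algebraMap ℤ_[3] (PadicAlgCl 3) (((Literature.NumberTheory.GaloisRepresentations.GaloisRep.cyclotomicCharacter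 (v.adicCompletion (CyclotomicField 3 ℚ)) 3 τ) ^ s : ℤ_[3]ˣ) : ℤ_[3])) ∧ (∀ U' : OpenSubgroup (Field.absoluteGaloisGroup (v.adicCompletion (CyclotomicField 3 ℚ))), ∃ τ ∈ U', (g⁻¹ * ρ (Literature.NumberTheory.GaloisRepresentations.absGaloisRestrict (CyclotomicField 3 ℚ) (v.adicCompletion (CyclotomicField 3 ℚ)) τ) * g).val k k ≠ algebraMap ℤ_[3] (PadicAlgCl 3) (((Literature.NumberTheory.GaloisRepresentations.GaloisRep.cyclotomicCharacter (v.adicCompletion (CyclotomicField 3 ℚ)) 3 τ) ^ s : ℤ_[3]ˣ) : ℤ_[3]) * (g⁻¹ * ρ (Literature.NumberTheory.GaloisRepresentations.absGaloisRestrict (CyclotomicField 3 ℚ) (v.adicCompletion (CyclotomicField 3 ℚ)) τ) * g).val i i)) ∧ ¬ IsSquare (f.map (Int.castRingHom ℚ)).discr ∧ ¬ IsSquare ((-3 : ℚ) * (f.map (Int.castRingHom ℚ)).discr)) ∧ (∀ v ∈ S₀, ((3 : ℕ) : (NumberField.RingOfIntegers (CyclotomicField 3 ℚ))) ∉ v.asIdeal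 → ∃ U : OpenSubgroup (Field.absoluteGaloisGroup (v.adicCompletion (CyclotomicField 3 ℚ))), ∀ τ ∈ Literature.NumberTheory.GaloisRepresentations.absInertia (v.adicCompletion (CyclotomicField 3 ℚ)), τ ∈ U → ρ (Literature.NumberTheory.GaloisRepresentations.absGaloisRestrict (CyclotomicField 3 ℚ) (v.adicCompletion (CyclotomicField 3 ℚ)) τ) = 1))) → (∃ (ι : PadicAlgCl 3 ≃+* ℂ) (e : (CyclotomicField 3 ℚ) →+* ℂ) (S₀ : Finset (IsDedekindDomain.HeightOneSpectrum (NumberField.RingOfIntegers (CyclotomicField 3 ℚ)))) (ρ : Literature.NumberTheory.GaloisRepresentations.FramedGaloisRep (CyclotomicField 3 ℚ) (PadicAlgCl 3) 3), ((∀ v : IsDedekindDomain.HeightOneSpectrum (NumberField.RingOfIntegers (CyclotomicField 3 ℚ)), ((3 : ℕ) : (NumberField.RingOfIntegers (CyclotomicField 3 ℚ))) ∈ v.asIdeal → v ∈ S₀) ∧ Literature.NumberTheory.GaloisRepresentations.FramedRep.IsAbsolutelyIrreducible ρ ∧ ∀ 𝔭 ∉ S₀, ρ.IsUnramifiedAt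 𝔭 ∧ ∀ 𝔓 ∈ 𝔭.primesAbove, ∀ τ : Field.absoluteGaloisGroup (CyclotomicField 3 ℚ), IsArithFrobAt (NumberField.RingOfIntegers (CyclotomicField 3 ℚ)) τ 𝔓 → Literature.NumberTheory.GaloisRepresentations.FramedRep.trace ρ τ⁻¹ = ι.symm (e (Literature.NumberTheory.GaloisRepresentations.picardTrace f 𝔭))) ∧ ((∀ v : IsDedekindDomain.HeightOneSpectrum (NumberField.RingOfIntegers (CyclotomicField 3 ℚ)), (3 : (NumberField.RingOfIntegers (CyclotomicField 3 ℚ))) ∈ v.asIdeal → ∃ (g : Matrix.GeneralLinearGroup (Fin 3) (PadicAlgCl 3)) (U : OpenSubgroup (Field.absoluteGaloisGroup (v.adicCompletion (CyclotomicField 3 ℚ)))) (i k : Fin 3) (s : ℤ), i ≠ k ∧ (i = 0 ∨ i = 2) ∧ (k = 0 ∨ k = 2) ∧ (s = 1 ∨ s = -1) ∧ (∀ τ : Field.absoluteGaloisGroup (v.adicCompletion (CyclotomicField 3 ℚ)), (g⁻¹ * ρ (Literature.NumberTheory.GaloisRepresentations.absGaloisRestrict (CyclotomicField 3 ℚ)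 (v.adicCompletion (CyclotomicField 3 ℚ)) τ) * g).val 1 0 = 0 ∧ (g⁻¹ * ρ (Literature.NumberTheory.GaloisRepresentations.absGaloisRestrict (CyclotomicField 3 ℚ) (v.adicCompletion (CyclotomicField 3 ℚ)) τ) * g).val 2 0 = 0 ∧ (g⁻¹ * ρ (Literature.NumberTheory.GaloisRepresentations.absGaloisRestrict (CyclotomicField 3 ℚ) (v.adicCompletion (CyclotomicField 3 ℚ)) τ) * g).val 2 1 = 0) ∧ (∀ τ ∈ Literature.NumberTheory.GaloisRepresentations.absInertia (v.adicCompletion (CyclotomicField 3 ℚ)), τ ∈ U → (g⁻¹ * ρ (Literature.NumberTheory.GaloisRepresentations.absGaloisRestrict (CyclotomicField 3 ℚ) (v.adicCompletion (CyclotomicField 3 ℚ)) τ) * g).val i i = 1 ∧ (g⁻¹ * ρ (Literature.NumberTheory.GaloisRepresentations.absGaloisRestrict (CyclotomicField 3 ℚ) (v.adicCompletion (CyclotomicField 3 ℚ)) τ) * g).val k k = algebraMap ℤ_[3] (PadicAlgCl 3) (((Literature.NumberTheory.GaloisRepresentations.GaloisRep.cyclotomicCharacter (v.adicCompletion (CyclotomicField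 3 ℚ)) 3 τ) ^ s : ℤ_[3]ˣ) : ℤ_[3])) ∧ (∀ U' : OpenSubgroup (Field.absoluteGaloisGroup (v.adicCompletion (CyclotomicField 3 ℚ))), ∃ τ ∈ U', (g⁻¹ * ρ (Literature.NumberTheory.GaloisRepresentations.absGaloisRestrict (CyclotomicField 3 ℚ) (v.adicCompletion (CyclotomicField 3 ℚ)) τ) * g).val k k ≠ algebraMap ℤ_[3] (PadicAlgCl 3) (((Literature.NumberTheory.GaloisRepresentations.GaloisRep.cyclotomicCharacter (v.adicCompletion (CyclotomicField 3 ℚ)) 3 τ) ^ s : ℤ_[3]ˣ) : ℤ_[3]) * (g⁻¹ * ρ (Literature.NumberTheory.GaloisRepresentations.absGaloisRestrict (CyclotomicField 3 ℚ) (v.adicCompletion (CyclotomicField 3 ℚ)) τ) * g).val i i)) ∧ ¬ IsSquare (f.map (Int.castRingHom ℚ)).discr ∧ ¬ IsSquare ((-3 : ℚ) * (f.map (Int.castRingHom ℚ)).discr))) → (∃ (P : Literature.NumberTheory.Automorphic.CuspidalAutomorphicRepData 3 (CyclotomicField 3 ℚ) hcpt) (𝔐 : Ideal (integralClosure ℤ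 ℂ)), P.1.IsRegularAlgebraic ∧ 𝔐.IsMaximal ∧ (3 : (integralClosure ℤ ℂ)) ∈ 𝔐 ∧ ∀ᶠ 𝔭 : IsDedekindDomain.HeightOneSpectrum (NumberField.RingOfIntegers (CyclotomicField 3 ℚ)) in Filter.cofinite, ∃ (α : Multiset ℂ) (Q : Polynomial (integralClosure ℤ ℂ)), P.1.HasSatakeParamAt 𝔭 α ∧ Q.map (algebraMap (integralClosure ℤ ℂ) ℂ) = (α.map (fun a => Polynomial.X - Polynomial.C ((𝔭.residueCard : ℂ) * a))).prod ∧ Q.map (Ideal.Quotient.mk 𝔐) = (if (f.map ((Ideal.Quotient.mk 𝔭.asIdeal).comp (algebraMap ℤ (NumberField.RingOfIntegers (CyclotomicField 3 ℚ))))).roots.toFinset.card = 4 then (Polynomial.X - 1) ^ 3 else if (f.map ((Ideal.Quotient.mk 𝔭.asIdeal).comp (algebraMap ℤ (NumberField.RingOfIntegers (CyclotomicField 3 ℚ))))).roots.toFinset.card = 2 then (Polynomial.X - 1) ^ 2 * (Polynomial.X + 1) else if (f.map ((Ideal.Quotient.mk 𝔭.asIdeal).comp (algebraMap ℤ (NumberField.RingOfIntegers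 (CyclotomicField 3 ℚ))))).roots.toFinset.card = 1 then Polynomial.X ^ 3 - 1 else if (∃ y : ((NumberField.RingOfIntegers (CyclotomicField 3 ℚ)) ⧸ 𝔭.asIdeal), y ^ 2 = (f.map ((Ideal.Quotient.mk 𝔭.asIdeal).comp (algebraMap ℤ (NumberField.RingOfIntegers (CyclotomicField 3 ℚ))))).discr) then (Polynomial.X - 1) * (Polynomial.X + 1) ^ 2 else Polynomial.X ^ 3 + Polynomial.X ^ 2 + Polynomial.X + 1 : Polynomial ℤ).map (Int.castRingHom ((integralClosure ℤ ℂ) ⧸ 𝔐))) → ∃ (e : CyclotomicField 3 ℚ →+* ℂ) (𝔐 : Ideal (integralClosure ℤ ℂ)) (S : Finset (IsDedekindDomain.HeightOneSpectrum (NumberField.RingOfIntegers (CyclotomicField 3 ℚ)))), 𝔐.IsMaximal ∧ (3 : (integralClosure ℤ ℂ)) ∈ 𝔐 ∧ ∀ k : ℕ, ∃ P : Literature.NumberTheory.Automorphic.CuspidalAutomorphicRepData 3 (CyclotomicField 3 ℚ) hcpt, P.1.IsRegularAlgebraic ∧ ∀ 𝔭 ∉ S, ∃ (α : Multiset ℂ)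 (t u : (integralClosure ℤ ℂ)), P.1.HasSatakeParamAt 𝔭 α ∧ (t : ℂ) = (𝔭.residueCard : ℂ) * α.sum - e (Literature.NumberTheory.GaloisRepresentations.picardTrace f 𝔭) ∧ u ∉ 𝔐 ∧ u * t ∈ Ideal.span {(3 : (integralClosure ℤ ℂ)) ^ k}) :=
  Iff.rfl

/-- Child C, unfolded (the exact term filed as the route item `RTRemainder`). -/
theorem rtRemainder_iff : RTRemainder ↔ (∀ (f : Polynomial ℤ) (hcpt : Literature.NumberTheory.Automorphic.isCompact_glFiniteIntegralLevel 3 (CyclotomicField 3 ℚ)), f.natDegree = 4 → (f.map (Int.castRingHom ℚ)).Separable → 12 ∣ Nat.card (f.map (Int.castRingHom ℚ)).Gal → ¬ (∃ (ι : PadicAlgCl 3 ≃+* ℂ) (e : (CyclotomicField 3 ℚ) →+* ℂ) (S₀ : Finset (IsDedekindDomain.HeightOneSpectrum (NumberField.RingOfIntegers (CyclotomicField 3 ℚ)))) (ρ : Literature.NumberTheory.GaloisRepresentations.FramedGaloisRep (CyclotomicField 3 ℚ) (PadicAlgCl 3) 3), ((∀ v : IsDedekindDomain.HeightOneSpectrum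 (NumberField.RingOfIntegers (CyclotomicField 3 ℚ)), ((3 : ℕ) : (NumberField.RingOfIntegers (CyclotomicField 3 ℚ))) ∈ v.asIdeal → v ∈ S₀) ∧ Literature.NumberTheory.GaloisRepresentations.FramedRep.IsAbsolutelyIrreducible ρ ∧ ∀ 𝔭 ∉ S₀, ρ.IsUnramifiedAt 𝔭 ∧ ∀ 𝔓 ∈ 𝔭.primesAbove, ∀ τ : Field.absoluteGaloisGroup (CyclotomicField 3 ℚ), IsArithFrobAt (NumberField.RingOfIntegers (CyclotomicField 3 ℚ)) τ 𝔓 → Literature.NumberTheory.GaloisRepresentations.FramedRep.trace ρ τ⁻¹ = ι.symm (e (Literature.NumberTheory.GaloisRepresentations.picardTrace f 𝔭))) ∧ ((∀ v : IsDedekindDomain.HeightOneSpectrum (NumberField.RingOfIntegers (CyclotomicField 3 ℚ)), (3 : (NumberField.RingOfIntegers (CyclotomicField 3 ℚ))) ∈ v.asIdeal → ∃ (g : Matrix.GeneralLinearGroup (Fin 3) (PadicAlgCl 3)) (U : OpenSubgroup (Field.absoluteGaloisGroup (v.adicCompletion (CyclotomicField 3 ℚ)))) (i k : Fin 3) (s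 : ℤ), i ≠ k ∧ (i = 0 ∨ i = 2) ∧ (k = 0 ∨ k = 2) ∧ (s = 1 ∨ s = -1) ∧ (∀ τ : Field.absoluteGaloisGroup (v.adicCompletion (CyclotomicField 3 ℚ)), (g⁻¹ * ρ (Literature.NumberTheory.GaloisRepresentations.absGaloisRestrict (CyclotomicField 3 ℚ) (v.adicCompletion (CyclotomicField 3 ℚ)) τ) * g).val 1 0 = 0 ∧ (g⁻¹ * ρ (Literature.NumberTheory.GaloisRepresentations.absGaloisRestrict (CyclotomicField 3 ℚ) (v.adicCompletion (CyclotomicField 3 ℚ)) τ) * g).val 2 0 = 0 ∧ (g⁻¹ * ρ (Literature.NumberTheory.GaloisRepresentations.absGaloisRestrict (CyclotomicField 3 ℚ) (v.adicCompletion (CyclotomicField 3 ℚ)) τ) * g).val 2 1 = 0) ∧ (∀ τ ∈ Literature.NumberTheory.GaloisRepresentations.absInertia (v.adicCompletion (CyclotomicField 3 ℚ)), τ ∈ U → (g⁻¹ * ρ (Literature.NumberTheory.GaloisRepresentations.absGaloisRestrict (CyclotomicField 3 ℚ) (v.adicCompletion (CyclotomicField 3 ℚ)) τ) * g).val i i =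 1 ∧ (g⁻¹ * ρ (Literature.NumberTheory.GaloisRepresentations.absGaloisRestrict (CyclotomicField 3 ℚ) (v.adicCompletion (CyclotomicField 3 ℚ)) τ) * g).val k k = algebraMap ℤ_[3] (PadicAlgCl 3) (((Literature.NumberTheory.GaloisRepresentations.GaloisRep.cyclotomicCharacter (v.adicCompletion (CyclotomicField 3 ℚ)) 3 τ) ^ s : ℤ_[3]ˣ) : ℤ_[3])) ∧ (∀ U' : OpenSubgroup (Field.absoluteGaloisGroup (v.adicCompletion (CyclotomicField 3 ℚ))), ∃ τ ∈ U', (g⁻¹ * ρ (Literature.NumberTheory.GaloisRepresentations.absGaloisRestrict (CyclotomicField 3 ℚ) (v.adicCompletion (CyclotomicField 3 ℚ)) τ) * g).val k k ≠ algebraMap ℤ_[3] (PadicAlgCl 3) (((Literature.NumberTheory.GaloisRepresentations.GaloisRep.cyclotomicCharacter (v.adicCompletion (CyclotomicField 3 ℚ)) 3 τ) ^ s : ℤ_[3]ˣ) : ℤ_[3]) * (g⁻¹ * ρ (Literature.NumberTheory.GaloisRepresentations.absGaloisRestrict (CyclotomicField 3 ℚ) (v.adicCompletion (CyclotomicField 3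 ℚ)) τ) * g).val i i)) ∧ ¬ IsSquare (f.map (Int.castRingHom ℚ)).discr ∧ ¬ IsSquare ((-3 : ℚ) * (f.map (Int.castRingHom ℚ)).discr))) → (∃ (P : Literature.NumberTheory.Automorphic.CuspidalAutomorphicRepData 3 (CyclotomicField 3 ℚ) hcpt) (𝔐 : Ideal (integralClosure ℤ ℂ)), P.1.IsRegularAlgebraic ∧ 𝔐.IsMaximal ∧ (3 : (integralClosure ℤ ℂ)) ∈ 𝔐 ∧ ∀ᶠ 𝔭 : IsDedekindDomain.HeightOneSpectrum (NumberField.RingOfIntegers (CyclotomicField 3 ℚ)) in Filter.cofinite, ∃ (α : Multiset ℂ) (Q : Polynomial (integralClosure ℤ ℂ)), P.1.HasSatakeParamAt 𝔭 α ∧ Q.map (algebraMap (integralClosure ℤ ℂ) ℂ) = (α.map (fun a => Polynomial.X - Polynomial.C ((𝔭.residueCard : ℂ) * a))).prod ∧ Q.map (Ideal.Quotient.mk 𝔐) = (if (f.map ((Ideal.Quotient.mk 𝔭.asIdeal).comp (algebraMap ℤ (NumberField.RingOfIntegers (CyclotomicField 3 ℚ))))).roots.toFinset.card = 4 then (Polynomial.X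 - 1) ^ 3 else if (f.map ((Ideal.Quotient.mk 𝔭.asIdeal).comp (algebraMap ℤ (NumberField.RingOfIntegers (CyclotomicField 3 ℚ))))).roots.toFinset.card = 2 then (Polynomial.X - 1) ^ 2 * (Polynomial.X + 1) else if (f.map ((Ideal.Quotient.mk 𝔭.asIdeal).comp (algebraMap ℤ (NumberField.RingOfIntegers (CyclotomicField 3 ℚ))))).roots.toFinset.card = 1 then Polynomial.X ^ 3 - 1 else if (∃ y : ((NumberField.RingOfIntegers (CyclotomicField 3 ℚ)) ⧸ 𝔭.asIdeal), y ^ 2 = (f.map ((Ideal.Quotient.mk 𝔭.asIdeal).comp (algebraMap ℤ (NumberField.RingOfIntegers (CyclotomicField 3 ℚ))))).discr) then (Polynomial.X - 1) * (Polynomial.X + 1) ^ 2 else Polynomial.X ^ 3 + Polynomial.X ^ 2 + Polynomial.X + 1 : Polynomial ℤ).map (Int.castRingHom ((integralClosure ℤ ℂ) ⧸ 𝔐))) → ∃ (e : CyclotomicField 3 ℚ →+* ℂ) (𝔐 : Ideal (integralClosure ℤ ℂ)) (S : Finset (IsDedekindDomain.HeightOneSpectrum (NumberField.RingOfIntegers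 (CyclotomicField 3 ℚ)))), 𝔐.IsMaximal ∧ (3 : (integralClosure ℤ ℂ)) ∈ 𝔐 ∧ ∀ k : ℕ, ∃ P : Literature.NumberTheory.Automorphic.CuspidalAutomorphicRepData 3 (CyclotomicField 3 ℚ) hcpt, P.1.IsRegularAlgebraic ∧ ∀ 𝔭 ∉ S, ∃ (α : Multiset ℂ) (t u : (integralClosure ℤ ℂ)), P.1.HasSatakeParamAt 𝔭 α ∧ (t : ℂ) = (𝔭.residueCard : ℂ) * α.sum - e (Literature.NumberTheory.GaloisRepresentations.picardTrace f 𝔭) ∧ u ∉ 𝔐 ∧ u * t ∈ Ideal.span {(3 : (integralClosure ℤ ℂ)) ^ k}) :=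
  Iff.rfl

/-! ## 4. How the live line's registered stubs distribute over the children (real proofs) -/

/-- **Child A from the live line WITHOUT its remainder stub and WITHOUT the Picard existence fact**: the proof of the landed
`MuOrdinaryFamilyRT_of_plus` (…ThorneReduction, p140646) run at the witness of `AttachedMinimal f` — minimal family (K2⁺) →
K1⁺ (finiteness + classicality over `F'`) → dominance (`algebraMap_injective_of_ringKrullDim_le`) → accumulation
(`stub_accumulation`, landed) → quadratic descent → dictionary (`stub_dictionary`, landed). -/
theorem rtMuOrdinaryMinimal_of_plus :
    T.stub_minimalFamily → T.stub_definiteHostPlus → S.stub_quadraticDescent → RTMuOrdinaryMinimal := by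
  intro h₂ h₃ h₅ f hcpt hdeg hsep hgal hatt hres
  have h₄ : S.stub_accumulation := stub_accumulation
  have h₆ : S.stub_dictionary := stub_dictionary
  have hgen : Generic f := ⟨hdeg, hsep, hgal⟩
  obtain ⟨ι, e, S₀, ρC, hin, hM⟩ := hatt
  have hS₀ : ∀ v : HeightOneSpectrum (𝓞 K), ((3 : ℕ) : 𝓞 K) ∈ v.asIdeal → v ∈ S₀ := hin.1
  have htr := hin.2.2
  obtain ⟨𝓕, hdim, hpur, hΛ⟩ := h₂ f ι e S₀ ρC hgen hin hM
  obtain ⟨hfin, F', _instF, _instNF, _instA, hcpt', S', D, E, hdegF', hE, hS', hDint, hDacc,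
      hclass⟩ := h₃ f ι e S₀ ρC 𝓕 hgen hin hM hdim hpur hΛ
  haveI : Module.Finite 𝓕.Λ 𝓕.R := hfin
  have hinj : Function.Injective (algebraMap 𝓕.Λ 𝓕.R) :=
    algebraMap_injective_of_ringKrullDim_le 𝓕.dim_le hdim
  let xq : 𝓕.R →+* PadicAlgCl 3 := 𝓕.j.comp (𝓕.x : 𝓕.R →+* 𝓕.𝒪)
  have hxq : ∀ r, xq r = 𝓕.j (𝓕.x r) := fun r => rfl
  have hdom : ∃ 𝔮 : Ideal 𝓕.R, 𝔮.IsPrime ∧ Ideal.comap (algebraMap 𝓕.Λ 𝓕.R) 𝔮 = ⊥ ∧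
      ∀ r ∈ 𝔮, xq r = 0 := by
    refine ⟨⊥, Ideal.isPrime_bot, ?_, fun r hr => ?_⟩
    · rw [← RingHom.ker_eq_comap_bot]
      exact (RingHom.injective_iff_ker_eq_bot _).mp hinj
    · rw [Ideal.mem_bot] at hr
      rw [hr, map_zero]
  have hxint : ∀ a : 𝓕.Λ, ‖xq (algebraMap 𝓕.Λ 𝓕.R a)‖ ≤ 1 := fun a => by
    rw [hxq]; exact 𝓕.j_norm_le _
  have hDacc' : ∀ M : ℕ, ∃ κ ∈ D, ∀ a : 𝓕.Λ,
      ‖κ a - xq (algebraMap 𝓕.Λ 𝓕.R a)‖ ≤ ((3 : ℝ)⁻¹) ^ M := by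
    intro M
    obtain ⟨κ, hκ, h⟩ := hDacc M
    exact ⟨κ, hκ, fun a => by rw [hxq]; exact h a⟩
  obtain ⟨S, hdesc⟩ := h₅ F' hdegF' hcpt hcpt' ι S'
  obtain ⟨𝔐, h𝔐max, h𝔐3, hdict⟩ := h₆ ι e
  refine ⟨e, 𝔐, S ∪ S₀, h𝔐max, h𝔐3, fun k => ?_⟩
  obtain ⟨y, hyD, hyx⟩ := h₄ 𝓕.Λ 𝓕.R xq D E hE hdom hxint hDint hDacc' k
  obtain ⟨ρy, hρyT, hρyirr, P', hP'reg, hP'⟩ := hclass y hyD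
  obtain ⟨P, hPreg, hP⟩ := hdesc ρy P' hρyirr hP'reg hP'
  refine ⟨P, hPreg, fun 𝔭 h𝔭 => ?_⟩
  have h𝔭S : 𝔭 ∉ S := fun h => h𝔭 (Finset.mem_union_left _ h)
  have h𝔭S₀ : 𝔭 ∉ S₀ := fun h => h𝔭 (Finset.mem_union_right _ h)
  have h3 : ((3 : ℕ) : 𝓞 K) ∉ 𝔭.asIdeal := fun h => h𝔭S₀ (hS₀ 𝔭 h)
  obtain ⟨⟨α, t₀, hα, ht₀⟩, hcompat⟩ := hP 𝔭 h𝔭S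
  have happrox : ∀ g, ‖FramedRep.trace ρy g - FramedRep.trace ρC g‖ ≤ ((3 : ℝ)⁻¹) ^ k := by
    intro g
    rw [hρyT g, ← 𝓕.x_trace g, ← hxq]
    exact hyx _
  obtain ⟨t, u, ht, hu, hut⟩ :=
    hdict k f ρC ρy 𝔭 α t₀ h3 (htr 𝔭 h𝔭S₀) ((hcompat h3) α hα).2 ht₀ happrox
  exact ⟨α, t, u, hα, ht, hu, hut⟩

/-- **Child A from the four real stubs of the live skeleton + the descent facts** (K1⁺ through the landed
`definiteHostPlus_of`; quadratic descent through the landed conditional `stub_quadraticDescent_of` and the tree's theorem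
`exists_twist_quadraticSign_holds`).  Compared with `MuOrdinaryFamilyRT_of_thorneStubs` (the parent): no `T.stub_remainderPlus`,
no `S.stub_picardFact`. -/
theorem rtMuOrdinaryMinimal_of_thorneStubs : T.stub_minimalFamily → T.stub_finiteOverWeights → T.stub_companions →
    T.stub_thorneLift → S.stub_descentFacts → RTMuOrdinaryMinimal :=
  fun h₁ h₂ h₃ h₄ h₆ =>
    rtMuOrdinaryMinimal_of_plus h₁ (definiteHostPlus_of h₂ h₃ h₄)
      (stub_quadraticDescent_of h₆.1 h₆.2.1 Literature.NumberTheory.Automorphic.exists_twist_quadraticSign_holds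
        h₆.2.2.1 h₆.2.2.2.1 h₆.2.2.2.2)

/-- Child B from the live line's conceded remainder stub: at the witness of `AttachedOrdinary f`, `MainClassPlus` fails
(else `AttachedMinimal f`), which is the hypothesis of `T.stub_remainderPlus` — no Picard fact needed. -/
theorem rtMuOrdinaryNonMinimal_of_remainderPlus : T.stub_remainderPlus → RTMuOrdinaryNonMinimal := by
  intro h₇ f hcpt hdeg hsep hgal hnot hatt hres
  obtain ⟨ι, e, S₀, ρC, hin, hMC⟩ := hatt
  have hM : ¬ MainClassPlus f S₀ ρC := fun hM => hnot ⟨ι, e, S₀, ρC, hin, hM⟩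
  exact h₇ f hcpt ι e S₀ ρC ⟨hdeg, hsep, hgal⟩ hin hM hres

/-- Child C from the live line's conceded remainder stub and the Picard existence fact (`S.stub_picardInput`, itself the
landed conditional `stub_picardInput_of` of `picardCurve_exists_lambdaAdicRep`): the fact's representation is not in
`MainClass` (else `AttachedOrdinary f`), hence not in `MainClassPlus`. -/
theorem rtRemainder_of_remainderPlus : S.stub_picardInput → T.stub_remainderPlus → RTRemainder := by
  intro h₁ h₇ f hcpt hdeg hsep hgal hnot hres
  have hgen : Generic f := ⟨hdeg, hsep, hgal⟩
  obtain ⟨ι, e, S₀, ρC, hin⟩ := h₁ f hgen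
  have hM : ¬ MainClassPlus f S₀ ρC := fun hM => hnot ⟨ι, e, S₀, ρC, hin, hM.1⟩
  exact h₇ f hcpt ι e S₀ ρC hgen hin hM hres

/-- Sanity: the parent recomposed from the distributed stubs agrees with the landed `MuOrdinaryFamilyRT_of_thorneStubs`. -/
example (h₁ : T.stub_minimalFamily) (h₂ : T.stub_finiteOverWeights) (h₃ : T.stub_companions) (h₄ : T.stub_thorneLift)
    (h₅ : T.stub_remainderPlus) (h₆ : T.stub_facts) : MuOrdinaryFamilyRT :=
  MuOrdinaryFamilyRT_of_subs (rtMuOrdinaryMinimal_of_thorneStubs h₁ h₂ h₃ h₄ h₆.2)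
    (rtMuOrdinaryNonMinimal_of_remainderPlus h₅) (rtRemainder_of_remainderPlus (stub_picardInput_of h₆.1) h₅)

end

end Summit.Langlands.Langlands.Cruxes.MuOrdinaryFamilyRT.Split
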